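import Summits.RiemannHypothesis.RiemannHypothesis.Theses.GroundBarta
import Summits.RiemannHypothesis.RiemannHypothesis.Theorems.WeilGroundStateGroundStatesConvergeToXiStubRePartGroundState
import Summits.RiemannHypothesis.RiemannHypothesis.Theorems.WeilParityEvenWinsArch
import Literature.NumberTheory.LFunctions.WeilSemilocalCompactnessProofs
import Literature.NumberTheory.LFunctions.WeilGroundEnergyParitySplit
import Literature.NumberTheory.LFunctions.WeilGroundState
import Literature.NumberTheory.LFunctions.AdversarialWeilPositivity
import HarnessLib

/-!
# RiemannHypothesis / GroundBarta — crux `PolarPerronFrobenius` (stmt-RiemannHypothesis-18390):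
# the RH-free half `EvenRealGroundState` and the reduction to a pure SIGN statement

Route `RiemannHypothesis/GroundBarta` (rev 1), crux #3 `PolarPerronFrobenius` ("Perron–Frobenius
survives the polar term, beyond every height"): `∀ A, ∃ a ≥ A, (EW a → GSP a)`, where `EW a` is the
window-`a` clause of `EvenWinsBeyondArch` (every odd normalised window test is matched up to any `δ > 0`
by an even one) and `GSP a` says that some ground state of the FULL windowed Weil form at `a` (junk-free
`∀ h ∀ δ ∀ᶠ n` encoding of an `L²`-limit of a normalised minimising sequence) is real and `≥ 0` a.e. on
`(-a, a)`.  Helper file (`--supports`), RH-free, Mathlib + landed tree material only, no definitions.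

What is proved (the planner's layer-2 split `EvenRealGroundState → PolarPersistence → crux`, first
arrow and the composition):
* `isWeilGroundState_iff_forall_eventually_le` — the junk-free clause inlined by the route items IS
  Literature's `IsWeilGroundState` (adapted from the refuter's readback in
  `Cruxes/GroundBartaFloor/GroundBartaFloorLogic.lean`, which Theorems files cannot import).
* `weilEvenGroundEnergy_le_weilOddGroundEnergy_of_evenWinsAt` — MATCHING ⇒ ORDER: `EW a → ε_ev(a) ≤ ε_od(a)`.
* `exists_even_isWeilGroundState`, `exists_even_real_isWeilGroundState` — **at every window `a > 0` with
  `ε_ev(a) ≤ ε_od(a)` the FULL form has an EVEN (indeed even REAL-VALUED) ground state**: an even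
  minimising sequence of the even sphere is minimising for `ε = min(ε_ev, ε_od) = ε_ev`; compactness of
  the form embedding (`ConnesConsaniMoscovici2025_thm_3_6_holds`, PROVED in the tree) gives an
  `L²`-convergent subsequence; the limit's even part has norm `≥ 1 - ‖eₙ - u‖₂ > 0`, so its normalised
  even part is an even ground state (`isWeilGroundState_evenPart`); Weil's distribution is real, so the
  normalised real (or imaginary) part is again a ground state (`isWeilGroundState_rePart/imPart`).
* `polarPerronFrobenius_iff_groundEnergy` — **normal form**: `PolarPerronFrobenius ↔ ∀ A, ∃ a ≥ A,
  (ε_ev(a) ≤ ε_od(a) → ∃ u, IsWeilGroundState a u ∧ (a.e. on (-a,a): Im u = 0 ∧ 0 ≤ Re u))`.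
* `polarPerronFrobenius_of_persistence` — **crux ⟸ `PolarPersistence`** (cofinally: at an even-winning
  window every EVEN REAL-VALUED ground state is one-signed a.e. on the open window, either sign) — the
  RH-bearing residue (CruxAttack-r1 F6: no Perron–Frobenius mechanism gives this sign; edge layer at
  scale `e^{-2πe^{2a}}`).
* `polarPerronFrobenius_of_frequently_lt`, `eventually_le_of_not_polarPerronFrobenius`,
  `eventually_not_oneSigned_of_not_polarPerronFrobenius`, `not_polarPerronFrobenius_iff` — vacuity
  channel (`∃ᶠ a, ε_od(a) < ε_ev(a)` gives the crux) and irrefutability (a refutation proves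
  `∀ᶠ a, ε_ev(a) ≤ ε_od(a)`, the tail of `NoParityCrossing` / CCM25 §8 "simple-even", order half).

References: E. Bombieri, Rend. Lincei (9) 11 (2000) §4 (Problem 2, Thm 3, Thm 5); A. Connes,
C. Consani, H. Moscovici, arXiv:2511.22755 (2025) Thm 3.6, §8; A. Connes, W. D. van Suijlekom,
arXiv:2511.23257 Thm 6.1; M. Suzuki (2026) Thm 1.4.
-/

set_option linter.dupNamespace false

noncomputable section

open MeasureTheory Complex Filter Set
open scoped Real Topology

namespace Summit.RiemannHypothesis.RiemannHypothesis.Theorems.PolarPerronFrobenius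

open Literature.NumberTheory.LFunctions
open Summit.RiemannHypothesis.RiemannHypothesis.Theses.GroundBarta

/-! ### The junk-free ground-state clause is `IsWeilGroundState` -/

/-- `ε(a) ≤ Re Q(h)` for every normalised window test `h` (the sphere is bounded below,
`bddBelow_weilQuadratic_sphere_holds`). [folklore] -/
theorem weilGroundEnergy_le_of_sphere {a : ℝ} {h : ℝ → ℂ} (hh : IsWeilTest h)
    (hsupp : tsupport h ⊆ Icc (-a) a) (hnorm : ∫ t, ‖h t‖ ^ 2 = (1 : ℝ)) :
    weilGroundEnergy a ≤ (weilQuadratic h).re :=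
  csInf_le (bddBelow_weilQuadratic_sphere_holds a) ⟨h, hh, hsupp, hnorm, rfl⟩

/-- On the normalised sphere of the window, "eventually `δ`-below every normalised window test" is the
same as "`Re Q(gₙ) → ε(a)`" (`ε(a)` is the infimum of a set bounded below containing every `Re Q(gₙ)`).
[folklore] -/
theorem forall_eventually_le_iff_tendsto_weilGroundEnergy {a : ℝ} {g : ℕ → ℝ → ℂ}
    (hg : ∀ n, IsWeilTest (g n) ∧ tsupport (g n) ⊆ Icc (-a) a ∧ ∫ t, ‖g n t‖ ^ 2 = (1 : ℝ)) :
    (∀ h : ℝ → ℂ, IsWeilTest h → tsupport h ⊆ Icc (-a) a → ∫ t, ‖h t‖ ^ 2 = (1 : ℝ) →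
        ∀ δ : ℝ, 0 < δ → ∀ᶠ n in atTop, (weilQuadratic (g n)).re ≤ (weilQuadratic h).re + δ) ↔
      Tendsto (fun n ↦ (weilQuadratic (g n)).re) atTop (𝓝 (weilGroundEnergy a)) := by
  -- adapted from the refuter's readback `Cruxes/GroundBartaFloor/GroundBartaFloorLogic.lean`
  set S : Set ℝ := {x : ℝ | ∃ g : ℝ → ℂ, IsWeilTest g ∧ tsupport g ⊆ Icc (-a) a ∧
    ∫ t : ℝ, ‖g t‖ ^ 2 = 1 ∧ x = (weilQuadratic g).re} with hSdef
  have hS : BddBelow S := bddBelow_weilQuadratic_sphere_holds a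
  have hε : weilGroundEnergy a = sInf S := rfl
  have hmem : ∀ n, (weilQuadratic (g n)).re ∈ S := fun n ↦
    ⟨g n, (hg n).1, (hg n).2.1, (hg n).2.2, rfl⟩
  have hne : S.Nonempty := ⟨_, hmem 0⟩
  have hlow : ∀ n, weilGroundEnergy a ≤ (weilQuadratic (g n)).re := fun n ↦
    hε ▸ csInf_le hS (hmem n)
  constructor
  · intro H
    rw [tendsto_order]
    refine ⟨fun x hx ↦ Eventually.of_forall fun n ↦ hx.trans_le (hlow n), fun x hx ↦ ?_⟩
    have hδ : 0 < (x - weilGroundEnergy a) / 2 := by linarith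
    have hlt : sInf S < weilGroundEnergy a + (x - weilGroundEnergy a) / 2 := by
      rw [← hε]; linarith
    obtain ⟨y, ⟨h, hh, hsupp, hnorm, rfl⟩, hy⟩ := exists_lt_of_csInf_lt hne hlt
    filter_upwards [H h hh hsupp hnorm _ hδ] with n hn
    linarith
  · intro H h hh hsupp hnorm δ hδ
    have hle : weilGroundEnergy a ≤ (weilQuadratic h).re :=
      weilGroundEnergy_le_of_sphere hh hsupp hnorm
    have hev : ∀ᶠ n in atTop, (weilQuadratic (g n)).re < weilGroundEnergy a + δ :=
      (tendsto_order.1 H).2 _ (by linarith)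
    filter_upwards [hev] with n hn
    linarith

/-- **The inlined ground-state clause IS `IsWeilGroundState`.** The route items (`GroundBartaFloor`,
`PolarPerronFrobenius`) encode "`u` is a ground state of the full windowed form at `a`" junk-free as
"`u ∈ L²` is the `L²`-limit of a normalised sequence of window tests eventually `δ`-below every normalised
window test"; this is Literature's `IsWeilGroundState a u` (`Re Q(gₙ) → ε(a)`). [folklore] -/
theorem isWeilGroundState_iff_forall_eventually_le (a : ℝ) (u : ℝ → ℂ) :
    IsWeilGroundState a u ↔
      (MemLp u 2 ∧ ∃ g : ℕ → ℝ → ℂ,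
        (∀ n, IsWeilTest (g n) ∧ tsupport (g n) ⊆ Icc (-a) a ∧ ∫ t, ‖g n t‖ ^ 2 = (1 : ℝ)) ∧
        (∀ h : ℝ → ℂ, IsWeilTest h → tsupport h ⊆ Icc (-a) a → ∫ t, ‖h t‖ ^ 2 = (1 : ℝ) →
          ∀ δ : ℝ, 0 < δ → ∀ᶠ n in atTop, (weilQuadratic (g n)).re ≤ (weilQuadratic h).re + δ) ∧
        Tendsto (fun n ↦ ∫ t, ‖g n t - u t‖ ^ 2) atTop (𝓝 0)) :=
  and_congr_right fun _ ↦ exists_congr fun _ ↦ and_congr_right fun hg ↦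
    and_congr_left fun _ ↦ (forall_eventually_le_iff_tendsto_weilGroundEnergy hg).symm

/-! ### Matching ⇒ order at one window -/

/-- **MATCHING ⇒ ORDER at one window** (converse of `WeilParity.evenWinsAt_of_le`): if every odd
normalised test `o` on `[-a, a]` is matched up to any `δ > 0` by an even normalised test `w` with
`Re Q(w) ≤ Re Q(o) + δ`, then `ε_ev(a) ≤ ε_od(a)` (`ε_ev(a) ≤ Re Q(w)`, and `ε_od(a)` is the infimum over
the nonempty odd sphere for `a > 0`). [folklore] -/
theorem weilEvenGroundEnergy_le_weilOddGroundEnergy_of_evenWinsAt {a : ℝ} (ha : 0 < a)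
    (hEW : ∀ o : ℝ → ℂ, IsWeilTest o → tsupport o ⊆ Icc (-a) a → (∀ t, o (-t) = -o t) →
      ∫ t, ‖o t‖ ^ 2 = (1 : ℝ) → ∀ δ : ℝ, 0 < δ → ∃ w : ℝ → ℂ, IsWeilTest w ∧
        tsupport w ⊆ Icc (-a) a ∧ (∀ t, w (-t) = w t) ∧ ∫ t, ‖w t‖ ^ 2 = (1 : ℝ) ∧
        (weilQuadratic w).re ≤ (weilQuadratic o).re + δ) :
    weilEvenGroundEnergy a ≤ weilOddGroundEnergy a := by
  refine le_weilOddGroundEnergy_of_forall ha fun o ho hos hodd hon ↦ ?_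
  refine le_of_forall_pos_le_add fun δ hδ ↦ ?_
  obtain ⟨w, hw, hws, hwev, hwn, hle⟩ := hEW o ho hos hodd hon δ hδ
  exact (weilEvenGroundEnergy_le hw hws hwev hwn).trans hle

/-! ### Even ground states of the full form at even-winning windows (RH-free) -/

/-- **An even ground state of the FULL form exists at every window `a > 0` at which the even sector
carries the bottom.**  If `ε_ev(a) ≤ ε_od(a)` then `ε(a) = ε_ev(a)` (`ε = min(ε_ev, ε_od)`), so an
`L²`-normalised sequence of EVEN window tests with `Re Q → ε_ev(a)` is a minimising sequence of the full
form; by the compactness of the form embedding (Connes–Consani–Moscovici 2025 Thm 3.6, PROVED in the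
tree as `ConnesConsaniMoscovici2025_thm_3_6_holds`) a subsequence converges in `L²` to a ground state
`u`; since the approximants are even, `‖uᵉ‖₂ ≥ ‖eₙ‖₂ - ‖(eₙ - u)ᵉ‖₂ ≥ 1 - ‖eₙ - u‖₂ > 0` for `n` large,
and the normalised even part of a ground state is a ground state (`isWeilGroundState_evenPart`).
[folklore] -/
theorem exists_even_isWeilGroundState {a : ℝ} (ha : 0 < a)
    (hle : weilEvenGroundEnergy a ≤ weilOddGroundEnergy a) :
    ∃ u : ℝ → ℂ, IsWeilGroundState a u ∧ ∀ t, u (-t) = u t := by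
  -- an even minimising sequence of the even sphere
  set S : Set ℝ := weilWindowSphereValues (fun g : ℝ → ℂ ↦ ∀ t, g (-t) = g t) a with hSdef
  have hne : S.Nonempty := weilWindowSphereValues_even_nonempty ha
  have hbdd : BddBelow S := bddBelow_weilWindowSphereValues _ a
  obtain ⟨x, -, hx, hmem⟩ := exists_seq_tendsto_sInf hne hbdd
  have hmem' : ∀ n, ∃ g : ℝ → ℂ, IsWeilTest g ∧ tsupport g ⊆ Icc (-a) a ∧ (∀ t, g (-t) = g t) ∧
      ∫ t : ℝ, ‖g t‖ ^ 2 = 1 ∧ x n = (weilQuadratic g).re := hmem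
  choose e he hes hev hen hxe using hmem'
  -- it is minimising for the FULL form: `ε(a) = min(ε_ev, ε_od) = ε_ev(a) = sInf S`
  have hεS : weilGroundEnergy a = sInf S := by
    rw [weilGroundEnergy_eq_min_even_odd, min_eq_left hle, weilEvenGroundEnergy_eq_sInf]
  have hQ : Tendsto (fun n ↦ (weilQuadratic (e n)).re) atTop (𝓝 (weilGroundEnergy a)) := by
    have hfun : (fun n ↦ (weilQuadratic (e n)).re) = x := funext fun n ↦ (hxe n).symm
    rw [hfun, hεS]
    exact hx
  -- compactness: a subsequence converges in `L²`
  obtain ⟨u, hu, φ, hφ, hconv⟩ := ConnesConsaniMoscovici2025_thm_3_6_holds a ha e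
    (fun n ↦ ⟨he n, hes n, hen n⟩) hQ.bddAbove_range
  have hgs : IsWeilGroundState a u :=
    ⟨hu, fun n ↦ e (φ n), fun n ↦ ⟨he _, hes _, hen _⟩, hQ.comp hφ.tendsto_atTop, hconv⟩
  -- the even part of `u` is not zero in `L²`
  set N : ℝ := ∫ t, ‖(u t + u (-t)) / 2‖ ^ 2 with hNdef
  have hN : 0 < N := by
    obtain ⟨n, hn⟩ := (hconv.eventually (gt_mem_nhds (by norm_num : (0 : ℝ) < 1))).exists
    set f : ℝ → ℂ := e (φ n) with hfdef
    have hfm : MemLp f 2 := (he _).1.continuous.memLp_of_hasCompactSupport (he _).2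
    have hfe : ∀ t, f (-t) = f t := hev _
    have huem : MemLp (fun t ↦ (u t + u (-t)) / 2) 2 := GroundStatesConvergeToXi.memLp_evenPart hu
    have hdm : MemLp (fun t ↦ ((f t - u t) + (f (-t) - u (-t))) / 2) 2 := by
      have := GroundStatesConvergeToXi.memLp_evenPart (hfm.sub hu)
      simpa only [Pi.sub_apply] using this
    -- `‖f‖₂ ≤ ‖uᵉ‖₂ + ‖(f - u)ᵉ‖₂` since `f = uᵉ + (f - u)ᵉ` pointwise (`f` is even)
    have h1 := sqrt_integral_norm_sq_sub_le huem (hdm.neg)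
    have e1 : (fun t ↦ ‖(u t + u (-t)) / 2 - -(((f t - u t) + (f (-t) - u (-t))) / 2)‖ ^ 2) =
        fun t ↦ ‖f t‖ ^ 2 := by
      funext t
      rw [hfe t]
      congr 2
      ring
    have e2 : (fun t ↦ ‖-(((f t - u t) + (f (-t) - u (-t))) / 2)‖ ^ 2) =
        fun t ↦ ‖((f t - u t) + (f (-t) - u (-t))) / 2‖ ^ 2 := by
      funext t
      rw [norm_neg]
    simp only [Pi.neg_apply] at h1
    rw [e1, e2, hen, Real.sqrt_one] at h1
    -- `‖(f - u)ᵉ‖₂ ≤ ‖f - u‖₂ < 1`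
    have h2 : ∫ t, ‖((f t - u t) + (f (-t) - u (-t))) / 2‖ ^ 2 ≤ ∫ t, ‖f t - u t‖ ^ 2 := by
      have := GroundStatesConvergeToXi.integral_norm_sq_evenPart_le_of_memLp (hfm.sub hu)
      simpa only [Pi.sub_apply] using this
    have h3 : Real.sqrt (∫ t, ‖((f t - u t) + (f (-t) - u (-t))) / 2‖ ^ 2) < 1 := by
      rw [← Real.sqrt_one]
      exact Real.sqrt_lt_sqrt (integral_nonneg fun _ ↦ by positivity) (lt_of_le_of_lt h2 hn)
    have h4 : 0 < Real.sqrt N := by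
      rw [hNdef]
      linarith
    exact Real.sqrt_pos.1 h4
  refine ⟨_, GroundStatesConvergeToXi.isWeilGroundState_evenPart hgs hN, fun t ↦ ?_⟩
  simp only [neg_neg, add_comm (u (-t)) (u t)]

/-- **An even REAL-VALUED ground state of the full form exists at every window `a > 0` at which the
even sector carries the bottom**: take the even ground state `v` of `exists_even_isWeilGroundState`;
Weil's distribution is real, so the normalised real part of `v` — or, if `Re v = 0` in `L²`, the
normalised imaginary part (`∫‖Re v‖² + ∫‖Im v‖² = 1`) — is again a ground state
(`isWeilGroundState_rePart` / `isWeilGroundState_imPart`), still even, and real-valued. [folklore] -/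
theorem exists_even_real_isWeilGroundState {a : ℝ} (ha : 0 < a)
    (hle : weilEvenGroundEnergy a ≤ weilOddGroundEnergy a) :
    ∃ u : ℝ → ℂ, IsWeilGroundState a u ∧ (∀ t, u (-t) = u t) ∧ ∀ t, (u t).im = 0 := by
  obtain ⟨v, hv, hvev⟩ := exists_even_isWeilGroundState ha hle
  have hsum := OddSector.integral_norm_sq_rePart_add_imPart hv.memLp
  rw [hv.integral_norm_sq] at hsum
  have h1 : 0 ≤ ∫ t, ‖(((v t).re : ℝ) : ℂ)‖ ^ 2 := integral_nonneg fun _ ↦ by positivity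
  rcases h1.eq_or_lt with hz | hpos
  · have hpos' : 0 < ∫ t, ‖(((v t).im : ℝ) : ℂ)‖ ^ 2 := by linarith
    refine ⟨_, GroundStatesConvergeToXi.isWeilGroundState_imPart hv hpos', fun t ↦ ?_, fun t ↦ ?_⟩
    · simp only [hvev t]
    · simp [Complex.mul_im]
  · refine ⟨_, GroundStatesConvergeToXi.isWeilGroundState_rePart hv hpos, fun t ↦ ?_, fun t ↦ ?_⟩
    · simp only [hvev t]
    · simp [Complex.mul_im]

/-- **Sign flip**: if a real-valued ground state is `≤ 0` a.e. on the open window then `-u` is a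
ground state that is real and `≥ 0` a.e. there (phase invariance `IsWeilGroundState.const_mul` with
`c = -1`). [folklore] -/
theorem exists_nonneg_of_nonpos {a : ℝ} {u : ℝ → ℂ} (hu : IsWeilGroundState a u)
    (hre : ∀ t, (u t).im = 0) (hneg : ∀ᵐ t : ℝ, t ∈ Ioo (-a) a → (u t).re ≤ 0) :
    ∃ v : ℝ → ℂ, IsWeilGroundState a v ∧ ∀ᵐ t : ℝ, t ∈ Ioo (-a) a → (v t).im = 0 ∧ 0 ≤ (v t).re := by
  refine ⟨fun t ↦ (-1 : ℂ) * u t, hu.const_mul (by simp), ?_⟩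
  filter_upwards [hneg] with t ht
  intro htI
  have := ht htI
  refine ⟨?_, ?_⟩
  · simp [hre t]
  · simp only [neg_mul, one_mul, Complex.neg_re]
    linarith

/-! ### The crux in ground-energy / `IsWeilGroundState` language -/

/-- The matrix of the crux at a witness window forces the window to be genuine: at `a ≤ 0` the
even-winning clause holds vacuously (no normalised odd test lives on a null window) while no minimising
sequence exists, so `EW a → GSP a` fails. [folklore] -/
theorem pos_of_polarMatrix {a : ℝ}
    (h : (∀ o : ℝ → ℂ, IsWeilTest o → tsupport o ⊆ Icc (-a) a → (∀ t, o (-t) = -o t) →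
        ∫ t, ‖o t‖ ^ 2 = (1 : ℝ) → ∀ δ : ℝ, 0 < δ → ∃ w : ℝ → ℂ, IsWeilTest w ∧
          tsupport w ⊆ Icc (-a) a ∧ (∀ t, w (-t) = w t) ∧ ∫ t, ‖w t‖ ^ 2 = (1 : ℝ) ∧
          (weilQuadratic w).re ≤ (weilQuadratic o).re + δ) →
      ∃ u : ℝ → ℂ, (MemLp u 2 ∧ ∃ g : ℕ → ℝ → ℂ,
        (∀ n, IsWeilTest (g n) ∧ tsupport (g n) ⊆ Icc (-a) a ∧ ∫ t, ‖g n t‖ ^ 2 = (1 : ℝ)) ∧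
        (∀ h : ℝ → ℂ, IsWeilTest h → tsupport h ⊆ Icc (-a) a → ∫ t, ‖h t‖ ^ 2 = (1 : ℝ) →
          ∀ δ : ℝ, 0 < δ → ∀ᶠ n in atTop, (weilQuadratic (g n)).re ≤ (weilQuadratic h).re + δ) ∧
        Tendsto (fun n ↦ ∫ t, ‖g n t - u t‖ ^ 2) atTop (𝓝 0)) ∧
        (∀ᵐ t : ℝ, t ∈ Ioo (-a) a → (u t).im = 0 ∧ 0 ≤ (u t).re)) :
    0 < a := by
  by_contra hle
  have ha : a ≤ 0 := not_lt.1 hle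
  have hEW : ∀ o : ℝ → ℂ, IsWeilTest o → tsupport o ⊆ Icc (-a) a → (∀ t, o (-t) = -o t) →
      ∫ t, ‖o t‖ ^ 2 = (1 : ℝ) → ∀ δ : ℝ, 0 < δ → ∃ w : ℝ → ℂ, IsWeilTest w ∧
        tsupport w ⊆ Icc (-a) a ∧ (∀ t, w (-t) = w t) ∧ ∫ t, ‖w t‖ ^ 2 = (1 : ℝ) ∧
        (weilQuadratic w).re ≤ (weilQuadratic o).re + δ := by
    intro o ho hos _ hon
    have h0 : o = 0 := ho.eq_zero_of_tsupport_subset hos ha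
    subst h0
    simp at hon
  obtain ⟨u, hu, -⟩ := h hEW
  exact hle (IsWeilGroundState.pos ((isWeilGroundState_iff_forall_eventually_le a u).2 hu))

/-- **Kernel-checked normal form of the crux.**  `PolarPerronFrobenius` holds if and only if beyond
every height there is a window `a` at which `ε_ev(a) ≤ ε_od(a)` (the even sector carries the bottom)
implies the existence of a ground state of the full windowed Weil form (`IsWeilGroundState a u`) that is
real and `≥ 0` a.e. on `(-a, a)`.  (`→`: a witness window is genuine, `pos_of_polarMatrix`; ORDER ⇒
MATCHING is `WeilParity.evenWinsAt_of_le`; the inlined clause is `IsWeilGroundState`.  `←`: apply the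
hypothesis beyond `max A 1` and use MATCHING ⇒ ORDER.) [folklore] -/
theorem polarPerronFrobenius_iff_groundEnergy :
    PolarPerronFrobenius ↔
      ∀ A : ℝ, ∃ a : ℝ, A ≤ a ∧ (weilEvenGroundEnergy a ≤ weilOddGroundEnergy a →
        ∃ u : ℝ → ℂ, IsWeilGroundState a u ∧
          ∀ᵐ t : ℝ, t ∈ Ioo (-a) a → (u t).im = 0 ∧ 0 ≤ (u t).re) := by
  constructor
  · intro h A
    obtain ⟨a, hA, hmat⟩ := h A
    have ha : 0 < a := pos_of_polarMatrix hmat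
    refine ⟨a, hA, fun hle ↦ ?_⟩
    obtain ⟨u, hu, hsign⟩ := hmat (WeilParity.evenWinsAt_of_le ha hle)
    exact ⟨u, (isWeilGroundState_iff_forall_eventually_le a u).2 hu, hsign⟩
  · intro h A
    obtain ⟨a, hA, hmat⟩ := h (max A 1)
    have ha : 0 < a := lt_of_lt_of_le one_pos ((le_max_right A 1).trans hA)
    refine ⟨a, (le_max_left A 1).trans hA, fun hEW ↦ ?_⟩
    obtain ⟨u, hu, hsign⟩ :=
      hmat (weilEvenGroundEnergy_le_weilOddGroundEnergy_of_evenWinsAt ha hEW)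
    exact ⟨u, (isWeilGroundState_iff_forall_eventually_le a u).1 hu, hsign⟩

/-- **The crux follows from the pure SIGN statement `PolarPersistence`** (the planner's layer-2 split,
with the RH-free half `EvenRealGroundState` discharged by `exists_even_real_isWeilGroundState`): if beyond
every height there is a window `a` at which, whenever the even sector carries the bottom
(`ε_ev(a) ≤ ε_od(a)`), every EVEN REAL-VALUED ground state of the full windowed form is ONE-SIGNED a.e.
on `(-a, a)` (either `≥ 0` or `≤ 0`), then `PolarPerronFrobenius`. [folklore] -/
theorem polarPerronFrobenius_of_persistence
    (h : ∀ A : ℝ, ∃ a : ℝ, A ≤ a ∧ (weilEvenGroundEnergy a ≤ weilOddGroundEnergy a →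
      ∀ u : ℝ → ℂ, IsWeilGroundState a u → (∀ t, u (-t) = u t) → (∀ t, (u t).im = 0) →
        (∀ᵐ t : ℝ, t ∈ Ioo (-a) a → 0 ≤ (u t).re) ∨ (∀ᵐ t : ℝ, t ∈ Ioo (-a) a → (u t).re ≤ 0))) :
    PolarPerronFrobenius := by
  refine polarPerronFrobenius_iff_groundEnergy.2 fun A ↦ ?_
  obtain ⟨a, hA, hmat⟩ := h (max A 1)
  have ha : 0 < a := lt_of_lt_of_le one_pos ((le_max_right A 1).trans hA)
  refine ⟨a, (le_max_left A 1).trans hA, fun hle ↦ ?_⟩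
  obtain ⟨u, hu, hev, hre⟩ := exists_even_real_isWeilGroundState ha hle
  rcases hmat hle u hu hev hre with hpos | hneg
  · refine ⟨u, hu, ?_⟩
    filter_upwards [hpos] with t ht
    exact fun htI ↦ ⟨hre t, ht htI⟩
  · exact exists_nonneg_of_nonpos hu hre hneg

/-- The variant with the sign asked of every even real-valued ground state UNCONDITIONALLY (no
even-winning proviso) at the witness windows. [folklore] -/
theorem polarPerronFrobenius_of_persistence'
    (h : ∀ A : ℝ, ∃ a : ℝ, A ≤ a ∧
      ∀ u : ℝ → ℂ, IsWeilGroundState a u → (∀ t, u (-t) = u t) → (∀ t, (u t).im = 0) →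
        (∀ᵐ t : ℝ, t ∈ Ioo (-a) a → 0 ≤ (u t).re) ∨ (∀ᵐ t : ℝ, t ∈ Ioo (-a) a → (u t).re ≤ 0)) :
    PolarPerronFrobenius :=
  polarPerronFrobenius_of_persistence fun A ↦
    (h A).imp fun _ ha ↦ ⟨ha.1, fun _ ↦ ha.2⟩

/-- **Cofinal one-signed ground states give the crux** (the even-winning hypothesis is a funnel only).
[folklore] -/
theorem polarPerronFrobenius_of_cofinal_oneSigned
    (h : ∀ A : ℝ, ∃ a : ℝ, A ≤ a ∧ ∃ u : ℝ → ℂ, IsWeilGroundState a u ∧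
      ∀ᵐ t : ℝ, t ∈ Ioo (-a) a → (u t).im = 0 ∧ 0 ≤ (u t).re) :
    PolarPerronFrobenius :=
  polarPerronFrobenius_iff_groundEnergy.2 fun A ↦ (h A).imp fun _ ha ↦ ⟨ha.1, fun _ ↦ ha.2⟩

/-- **Vacuity channel**: if the ODD sector wins strictly at arbitrarily large windows
(`∃ᶠ a, ε_od(a) < ε_ev(a)`, i.e. the even sector fails to carry the bottom cofinally), the crux holds with
no Perron–Frobenius content at all. [folklore] -/
theorem polarPerronFrobenius_of_frequently_lt
    (h : ∃ᶠ a in atTop, weilOddGroundEnergy a < weilEvenGroundEnergy a) :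
    PolarPerronFrobenius := by
  refine polarPerronFrobenius_iff_groundEnergy.2 fun A ↦ ?_
  obtain ⟨a, hA, hlt⟩ := frequently_atTop.1 h A
  exact ⟨a, hA, fun hle ↦ absurd hlt (not_lt.2 hle)⟩

/-- **Irrefutability short of eventual even dominance**: a refutation of the crux PROVES that the even
sector carries the bottom at every large window, `∀ᶠ a, ε_ev(a) ≤ ε_od(a)` — the tail of
`WeilParity.NoParityCrossing` / the ORDER half of Connes–Consani–Moscovici's open "simple-even" step.
[folklore] -/
theorem eventually_le_of_not_polarPerronFrobenius (h : ¬ PolarPerronFrobenius) :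
    ∀ᶠ a in atTop, weilEvenGroundEnergy a ≤ weilOddGroundEnergy a := by
  by_contra hne
  refine h (polarPerronFrobenius_of_frequently_lt ?_)
  exact (not_eventually.1 hne).mono fun a ha ↦ not_le.1 ha

/-- … AND that no large window carries a one-signed ground state of the full form. [folklore] -/
theorem eventually_not_oneSigned_of_not_polarPerronFrobenius (h : ¬ PolarPerronFrobenius) :
    ∀ᶠ a in atTop, ∀ u : ℝ → ℂ, IsWeilGroundState a u →
      ¬ (∀ᵐ t : ℝ, t ∈ Ioo (-a) a → (u t).im = 0 ∧ 0 ≤ (u t).re) := by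
  by_contra hne
  refine h (polarPerronFrobenius_of_cofinal_oneSigned fun A ↦ ?_)
  obtain ⟨a, hA, ha⟩ := frequently_atTop.1 (not_eventually.1 hne) A
  simp only [not_forall, not_not] at ha
  obtain ⟨u, hu, hsign⟩ := ha
  exact ⟨a, hA, u, hu, hsign⟩

/-- Negation normal form: `¬ PolarPerronFrobenius` iff beyond some height EVERY window is even-winning
and carries NO one-signed ground state. [folklore] -/
theorem not_polarPerronFrobenius_iff :
    ¬ PolarPerronFrobenius ↔ ∃ A : ℝ, ∀ a : ℝ, A ≤ a →
      weilEvenGroundEnergy a ≤ weilOddGroundEnergy a ∧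
        ∀ u : ℝ → ℂ, IsWeilGroundState a u →
          ¬ (∀ᵐ t : ℝ, t ∈ Ioo (-a) a → (u t).im = 0 ∧ 0 ≤ (u t).re) := by
  rw [polarPerronFrobenius_iff_groundEnergy]
  constructor
  · intro h
    by_contra hc
    refine h fun A ↦ ?_
    by_contra hA
    refine hc ⟨A, fun a ha ↦ ?_⟩
    by_contra hm
    refine hA ⟨a, ha, fun hle ↦ ?_⟩
    by_contra hex
    exact hm ⟨hle, fun u hu hs ↦ hex ⟨u, hu, hs⟩⟩
  · rintro ⟨A, hA⟩ h
    obtain ⟨a, ha, hmat⟩ := h A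
    obtain ⟨hle, hno⟩ := hA a ha
    obtain ⟨u, hu, hs⟩ := hmat hle
    exact hno u hu hs

end Summit.RiemannHypothesis.RiemannHypothesis.Theorems.PolarPerronFrobenius

end
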